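import Mathlib

/-!
# `SnSubsetDichotomy.HyperoctahedralThreshold` — stub `stub_goodTwin`

Two good fixed points give a clean twin (line `refutation-local-symmetry` of crux
`stmt-MatrixMultiplication-10883`, registered stub `stub_goodTwin` of the lead's skeleton).

Setting: three involutions `μ 0, μ 1, μ 2` of `Fin n`; a colour word `z : List (Fin 3)` acts on
the right, `v · z = z.foldl (fun v c => μ c v) v` (first letter first); the trajectory of `v` is
`t ↦ v · z.take t`.  A fixed point `v · z = v` is *good* when its trajectory on `Fin z.length` is
injective.  Claim: if `z` (length `ℓ ≥ 2`, cyclically reduced: `List.IsChain (· ≠ ·) (z ++ z)`)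
has `m ≥ ℓ · |R| + ℓ ^ 2 + 2` distinct good fixed points `x i`, then two of them have disjoint
trajectories avoiding `R`; they are output as clean-cycle data `p, q, col` on `Fin (k + 2)` with
`k + 2 = ℓ` (the input format of `stub_cycleGadget`).

Proof.  For each `t` the map `v ↦ v · z.take t` is injective (`GoodTwin.foldl_injective`, a
composite of the permutations `μ c`), and so is `x`; hence for each `t < ℓ` at most `|R|` indices
`i` have their `t`-th trajectory point in `R`, and at most `ℓ · |R|` indices meet `R` at all
(`Finset.card_biUnion_le_card_mul`).  Fix an `R`-free index `i₁`.  An index `j` *conflicts* with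
`i₁` when `x j · z.take t = x i₁ · z.take s` for some `s, t < ℓ`; for each pair `(s, t)` there is
at most one such `j`, so at most `ℓ ^ 2` indices conflict, and since `m - ℓ · |R| ≥ ℓ ^ 2 + 2`
some `R`-free index `i₂` does not.  Output `p t := x i₁ · z.take t`, `q t := x i₂ · z.take t`,
`col t := z[t]`.  The step identity `μ (z[t]) (v · z.take t) = v · z.take ((t + 1) % ℓ)`
(`GoodTwin.foldl_take_step`) is `List.take_succ_eq_append_getElem` plus, at the wrap `t + 1 = ℓ`,
the fixed-point equation; consecutive colours differ cyclically by `List.IsChain.getElem` on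
`z ++ z` (`GoodTwin.cyclic_ne`); `Fin (k + 2)`-successors are read through `Fin.val_add`.
-/

namespace Summit.MatrixMultiplication.MatrixMultiplication.Theorems.HyperoctahedralThreshold

open Equiv

namespace GoodTwin

/-- A colour word acts injectively (it acts by a composite of the permutations `μ c`).
[folklore] -/
theorem foldl_injective {n : ℕ} (μ : Fin 3 → Perm (Fin n)) (w : List (Fin 3)) :
    Function.Injective fun v : Fin n => w.foldl (fun v c => μ c v) v := by
  induction w with
  | nil => exact fun a b h => h
  | cons c w ih =>
    intro a b h
    simp only [List.foldl_cons] at h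
    exact (μ c).injective (ih h)

/-- One step along the trajectory `t ↦ v · z.take t` of a fixed point `v` of `z`, cyclically:
applying the letter `z[t]` to the `t`-th trajectory point gives the `(t + 1) % z.length`-th one.
[folklore] -/
theorem foldl_take_step {n : ℕ} (μ : Fin 3 → Perm (Fin n)) (z : List (Fin 3)) (v : Fin n)
    (hfix : z.foldl (fun v c => μ c v) v = v) (t : ℕ) (ht : t < z.length) :
    μ z[t] ((z.take t).foldl (fun v c => μ c v) v) =
      (z.take ((t + 1) % z.length)).foldl (fun v c => μ c v) v := by
  have h1 : (z.take (t + 1)).foldl (fun v c => μ c v) v =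
      μ z[t] ((z.take t).foldl (fun v c => μ c v) v) := by
    rw [List.take_succ_eq_append_getElem ht, List.foldl_append, List.foldl_cons, List.foldl_nil]
  rw [← h1]
  rcases (show t + 1 < z.length ∨ t + 1 = z.length by omega) with h | h
  · rw [Nat.mod_eq_of_lt h]
  · rw [h, Nat.mod_self, List.take_length, List.take_zero, List.foldl_nil, hfix]

/-- Consecutive letters of a cyclically reduced word differ, also across the wrap. [folklore] -/
theorem cyclic_ne {z : List (Fin 3)} (hc : List.IsChain (· ≠ ·) (z ++ z)) (s t : ℕ)
    (hs : s < z.length) (ht : t < z.length) (hst : t = (s + 1) % z.length) : z[s] ≠ z[t] := by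
  have h : (z ++ z)[s]'(by rw [List.length_append]; omega) ≠
      (z ++ z)[s + 1]'(by rw [List.length_append]; omega) :=
    hc.getElem s (by rw [List.length_append]; omega)
  rw [List.getElem_append_left hs] at h
  rcases (show s + 1 < z.length ∨ s + 1 = z.length by omega) with h1 | h1
  · rw [Nat.mod_eq_of_lt h1] at hst
    subst hst
    rwa [List.getElem_append_left h1] at h
  · rw [h1, Nat.mod_self] at hst
    subst hst
    rw [List.getElem_append_right h1.ge] at h
    simpa [h1] using h

end GoodTwin

open GoodTwin in
/-- **Stub `stub_goodTwin` — two good fixed points give a clean twin** (line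
`refutation-local-symmetry` of crux `SnSubsetDichotomy.HyperoctahedralThreshold`,
stmt-MatrixMultiplication-10883).  For three involutions `μ c` of `Fin n` and a cyclically
reduced colour word `z` of length `ℓ ≥ 2`: among `m ≥ ℓ · |R| + ℓ ^ 2 + 2` distinct good fixed
points `x i` of `z` (fixed points with injective trajectory `t ↦ x i · z.take t` on `Fin ℓ`)
there are two whose trajectories avoid `R` and each other; they form clean-cycle data
`p t := x i₁ · z.take t`, `q t := x i₂ · z.take t`, `col t := z[t]` on `Fin (k + 2)`, `k + 2 = ℓ`
(at most `ℓ · |R|` indices meet `R`, at most `ℓ ^ 2` conflict with a fixed `R`-free `i₁`;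
`GoodTwin.foldl_take_step`, `GoodTwin.cyclic_ne`). [folklore] -/
theorem stub_goodTwin : ∀ (n : ℕ) (μ : Fin 3 → Equiv.Perm (Fin n)) (R : Finset (Fin n)) (z : List (Fin 3)) (m : ℕ) (x : Fin m → Fin n), (∀ c, μ c * μ c = 1) → 2 ≤ z.length → List.IsChain (· ≠ ·) (z ++ z) → Function.Injective x → (∀ i, z.foldl (fun v c => μ c v) (x i) = x i) → (∀ i, Function.Injective (fun t : Fin z.length => (z.take (t : ℕ)).foldl (fun v c => μ c v) (x i))) → z.length * R.card + z.length ^ 2 + 2 ≤ m → ∃ (k : ℕ) (p q : Fin (k + 2) → Fin n) (col : Fin (k + 2) → Fin 3), Function.Injective p ∧ Function.Injective q ∧ (∀ i j, p i ≠ q j) ∧ (∀ i, μ (col i) (p i) = p (i + 1) ∧ μ (col i) (q i) = q (i + 1)) ∧ (∀ i, col i ≠ col (i + 1)) ∧ (∀ i, p i ∉ R ∧ q i ∉ R) ∧ k + 2 = z.length := by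
  intro n μ R z m x _ hlen hchain hx hfix hgood hm
  classical
  -- at a fixed time `t` the trajectory points `x i · z.take t` are pairwise distinct
  have hTi : ∀ t, Function.Injective fun i => (z.take t).foldl (fun v c => μ c v) (x i) :=
    fun t a b h => hx (foldl_injective μ (z.take t) h)
  -- (1) at most `ℓ |R|` indices have a trajectory point in `R`
  obtain ⟨Bad, hBad_mem, hBad⟩ : ∃ Bad : Finset (Fin m),
      (∀ i, i ∉ Bad → ∀ t < z.length, (z.take t).foldl (fun v c => μ c v) (x i) ∉ R) ∧
      Bad.card ≤ z.length * R.card := by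
    refine ⟨(Finset.range z.length).biUnion fun t =>
        Finset.univ.filter fun i => (z.take t).foldl (fun v c => μ c v) (x i) ∈ R, ?_, ?_⟩
    · intro i hi t ht hR
      exact hi (Finset.mem_biUnion.2
        ⟨t, Finset.mem_range.2 ht, Finset.mem_filter.2 ⟨Finset.mem_univ _, hR⟩⟩)
    · calc _ ≤ (Finset.range z.length).card * R.card :=
            Finset.card_biUnion_le_card_mul _ _ _ fun t _ =>
              Finset.card_le_card_of_injOn (fun i => (z.take t).foldl (fun v c => μ c v) (x i))
                (fun i hi => (Finset.mem_filter.1 (Finset.mem_coe.1 hi)).2) (hTi t).injOn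
        _ = z.length * R.card := by rw [Finset.card_range]
  have hGood : z.length ^ 2 + 2 ≤ (Finset.univ \ Bad).card := by
    have h := Finset.card_sdiff_add_card_eq_card (Finset.subset_univ Bad)
    rw [Finset.card_univ, Fintype.card_fin] at h
    omega
  -- (2) an `R`-free index `i₁`; at most `ℓ ^ 2` indices conflict with it
  obtain ⟨i₁, hi₁⟩ : (Finset.univ \ Bad).Nonempty := Finset.card_pos.1 (by omega)
  have hi₁B : i₁ ∉ Bad := (Finset.mem_sdiff.1 hi₁).2
  obtain ⟨Conf, hConf_mem, hConf⟩ : ∃ Conf : Finset (Fin m),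
      (∀ j, j ∉ Conf → ∀ s < z.length, ∀ t < z.length,
        (z.take t).foldl (fun v c => μ c v) (x j) ≠ (z.take s).foldl (fun v c => μ c v) (x i₁)) ∧
      Conf.card ≤ z.length ^ 2 := by
    refine ⟨(Finset.range z.length ×ˢ Finset.range z.length).biUnion fun st =>
        Finset.univ.filter fun j =>
          (z.take st.2).foldl (fun v c => μ c v) (x j) =
            (z.take st.1).foldl (fun v c => μ c v) (x i₁), ?_, ?_⟩
    · intro j hj s hs t ht h
      exact hj (Finset.mem_biUnion.2 ⟨(s, t),
        Finset.mem_product.2 ⟨Finset.mem_range.2 hs, Finset.mem_range.2 ht⟩,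
        Finset.mem_filter.2 ⟨Finset.mem_univ _, h⟩⟩)
    · calc _ ≤ (Finset.range z.length ×ˢ Finset.range z.length).card * 1 :=
            Finset.card_biUnion_le_card_mul _ _ _ fun st _ =>
              Finset.card_le_one.2 fun a ha b hb =>
                hTi st.2 (((Finset.mem_filter.1 ha).2).trans ((Finset.mem_filter.1 hb).2).symm)
        _ = z.length ^ 2 := by rw [Finset.card_product, Finset.card_range, mul_one, sq]
  obtain ⟨i₂, hi₂G, hi₂C⟩ : ∃ i₂, i₂ ∈ Finset.univ \ Bad ∧ i₂ ∉ Conf :=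
    Finset.exists_mem_notMem_of_card_lt_card (by omega)
  have hi₂B : i₂ ∉ Bad := (Finset.mem_sdiff.1 hi₂G).2
  -- (3) the output, indexed by `Fin (k + 2)` with `k + 2 = ℓ`
  obtain ⟨k, hk⟩ : ∃ k, k + 2 = z.length := ⟨z.length - 2, by omega⟩
  have hlt : ∀ i : Fin (k + 2), (i : ℕ) < z.length := fun i => i.isLt.trans_eq hk
  have hval : ∀ i : Fin (k + 2), ((i + 1 : Fin (k + 2)) : ℕ) = ((i : ℕ) + 1) % z.length :=
    fun i => by
      rw [Fin.val_add, Fin.val_one]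
      exact congrArg (fun N => ((i : ℕ) + 1) % N) hk
  refine ⟨k, fun i => (z.take i).foldl (fun v c => μ c v) (x i₁),
    fun i => (z.take i).foldl (fun v c => μ c v) (x i₂), fun i => z[(i : ℕ)]'(hlt i),
    ?_, ?_, ?_, ?_, ?_, ?_, hk⟩
  · -- `p` injective: goodness of `x i₁`
    exact (hgood i₁).comp (Fin.cast_injective hk)
  · -- `q` injective: goodness of `x i₂`
    exact (hgood i₂).comp (Fin.cast_injective hk)
  · -- the two trajectories are disjoint: `i₂` does not conflict with `i₁`
    intro i j h
    exact hConf_mem i₂ hi₂C i (hlt i) j (hlt j) h.symm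
  · -- the colour `z[t]` maps rung `t` onto rung `t + 1`, on both trajectories
    intro i
    refine ⟨?_, ?_⟩
    · show μ (z[(i : ℕ)]'(hlt i)) ((z.take i).foldl (fun v c => μ c v) (x i₁)) =
        (z.take ((i + 1 : Fin (k + 2)) : ℕ)).foldl (fun v c => μ c v) (x i₁)
      rw [hval i]
      exact foldl_take_step μ z (x i₁) (hfix i₁) i (hlt i)
    · show μ (z[(i : ℕ)]'(hlt i)) ((z.take i).foldl (fun v c => μ c v) (x i₂)) =
        (z.take ((i + 1 : Fin (k + 2)) : ℕ)).foldl (fun v c => μ c v) (x i₂)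
      rw [hval i]
      exact foldl_take_step μ z (x i₂) (hfix i₂) i (hlt i)
  · -- consecutive colours differ, cyclically
    intro i
    exact cyclic_ne hchain i _ (hlt i) (hlt (i + 1)) (hval i)
  · -- both trajectories avoid `R`
    intro i
    exact ⟨hBad_mem i₁ hi₁B i (hlt i), hBad_mem i₂ hi₂B i (hlt i)⟩

end Summit.MatrixMultiplication.MatrixMultiplication.Theorems.HyperoctahedralThreshold
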